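import Literature.MathematicalPhysics.QuantumFieldTheory.Balaban1983to89.B14Lem280Ward
import Literature.MathematicalPhysics.QuantumFieldTheory.Balaban1983to89.B12Schur433

/-!
# `Balaban1983to89.B14.Lem280WardLie` — T. Bałaban, *Convergent renormalization expansions for lattice gauge theories*,
# Commun. Math. Phys. **119** (1988) 243–285 [Balaban1988Convergent]: (3.51)/(3.55) for the SCALAR KERNEL TABLE of a
# NONABELIAN gauge-invariant functional — the model note (M1) of `B14Lem280Ward` («scalar bond-field components; the
# trace-form reduction of the 𝔤⊗𝔤-valued kernel, [I] (4.33), is not reproduced») DISCHARGED: [I] (4.15)₁ for 𝔤-valued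
# fields (`B12Semisimple414.hessian_chart_apply_grad_eq_zero`) and the Schur step after (4.33)
# (`B12Schur433.hessian_chart_eq_sum_scalar_kernel`) give the first Ward–Takahashi identity IN KERNEL FORM for the scalar
# table `𝐄_{μν}(x, y)` of `⟨𝐄^{(2)}, A⊗B⟩ = 𝐄 tr AB`, hence (3.54) ⇒ (3.51) ⇒ (3.55) for it by `B14Lem280Ward` §1

statement-level skeleton of published theorems with citation tags; proofs where landed; nothing here is a claim about the Yang–Mills mass gap

PDF held: `paper:balaban1988-cmp119-convergent-renormalization` (journal page = PDF page + 242), pp. 280–281 [PDF 38–39]; [I] =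
[Balaban1987RG1] pp. 284, 289 quoted from the module docstrings of `B12Semisimple414`/`B12Schur433` (cell readings of the
renders `1987-cmp109-rg-I-small-field-p036-x2.png`, `-p041-x2.png`).

CITATION HEADER (lean-in-tree rule).  WHAT IS REPRODUCED, verbatim.  [Balaban1988Convergent] p. 280: *"Σ_{n=1}^{4}
(1/n!)⟨𝐄^{(n)}(X, z), ⊗ⁿB⟩ = Σ_{μ,ν,κ,λ}[Σ_{x,y}𝐄^{(2)}_{μν}(X, x, y, z)(x_κ − z_κ)(y_λ − z_λ)] · ½ tr(…)(…) + (the irrelevant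
terms) (3.49)"* (a SCALAR kernel multiplying a trace form); p. 281: *"… = Σ_{x,μ}(∂_μλ)(x)𝐄^{(2)}_{μν}(X, x, y, z) = 0 (3.54)
by the first identity (I.4.15)."*  [Balaban1987RG1] p. 284 (4.15)₁: *"⟨(δ²/δB²)𝐄(1), B₁, ∂λ⟩ = 0 … for an arbitrary gauge
function λ, and arbitrary gauge fields B₁"*; p. 289: *"R(v)⊗R(v)𝐄^{(2)}_{μ,ν}(x, y) = 𝐄^{(2)}_{μ,ν}(x, y), v ∈ G. (4.33) …
With our assumptions on the group G the identity (4.33) holds for 𝐄 if and only if 𝐄_ab is proportional to the identity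
matrix, 𝐄_ab = 𝐄δ_ab, and then ⟨𝐄, A⊗B⟩ = 𝐄 tr AB."*

SKELETON rows (owner r11): **B14.Lem@280**, **B14.Eq3.55–3.57**, **B14.Eq3.49–3.50** (model note M1 of the 𝔤-valued
reading).  WHAT IS PROVED.  §1 (abstract, any coefficients): if a second derivative `H` on 𝔤-valued bond fields
(`u : Λ → T → V`, `V ≃ 𝔤`) is REPRESENTED through an invariant form, `H(u, v) = Σ_{μ,x,ν,y} β(u_μ(x), v_ν(y))·E(μ,x;ν,y)`
(the output shape of `B12Schur433.hessian_chart_eq_sum_scalar_kernel`), and satisfies (I.4.15)₁ `H(u, ∂λ) = 0` for all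
𝔤-valued `u, λ` (the output shape of `B12Semisimple414.hessian_chart_apply_grad_eq_zero`), then the SCALAR TABLE `E`
satisfies the first Ward–Takahashi identity in kernel form, `Σ_{y,ν}(φ(y + e_ν) − φ(y))·E(μ,x;ν,y) = 0` for every SCALAR
gauge function `φ` (`wardY_scalarTable`: test `u = δ_{(μ,x)}a`, `λ = φ·l` with `β(a, l) ≠ 0`); `x`-slot from
`H(∂λ, v) = 0` (`wardX_scalarTable`).  §2 (the lineage's setting): for `𝐄` `C³` at `V = 1` on `𝔄`-valued lattice gauge
fields, gauge invariant near `1` under the flows of all 𝔤-valued gauge functions ((4.7)), `G` semisimple with scalar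
centroid and `β` invariant nondegenerate: the scalar table `E` of the chart Hessian EXISTS and satisfies both kernel-form
identities (`scalarTable_ward_of_gaugeInvariance`).  §3 (real-valued 𝐄, directions `Fin d`): hence, on a window `W` where the
kernel is localized and the coordinates are affine along the shifts, the scalar table satisfies (3.51) and both
antisymmetries (3.55) of its moment table (`eq355_scalarTable_of_gaugeInvariance`, by `B14.Lem280Ward.eq351`/`eq355a`/
`eq355b`).  Theorems only; no `sorry`.

Mega-formalization `lit-balaban`, unit `lit-balaban-r11` gen 5 (B14 fold owner), HOME `run/shared/lean/pub/lit-balaban/`.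

## References
* [Balaban1988Convergent] T. Bałaban, Commun. Math. Phys. 119 (1988) 243–285, (3.49)–(3.55) pp. 280–281.
* [Balaban1987RG1] T. Bałaban, Commun. Math. Phys. 109 (1987) 249–301 ([I]: (4.7) p.282, (4.15) p.284, (4.32)–(4.33) p.289).
-/

namespace Literature.MathematicalPhysics.QuantumFieldTheory.Balaban1983to89.B14.Lem280WardLie

open Finset
open _root_.Filter _root_.Topology
open NormedSpace (exp)
open Literature.MathematicalPhysics.QuantumFieldTheory.Balaban1983to89
open Literature.MathematicalPhysics.QuantumFieldTheory.Balaban1983to89.B14.Eq356FieldStrength (moment2)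

/-! ## §1. From the represented Hessian and (I.4.15)₁ on 𝔤-valued fields to the kernel form for the scalar table -/

section ScalarTable

variable {Λ T V F : Type*} [Fintype Λ] [Fintype T] [DecidableEq Λ] [DecidableEq T]
  [AddCommGroup V] [Module ℝ V] [AddCommGroup F] [Module ℝ F] [NoZeroSMulDivisors ℝ F]
  {𝔤 : Type*} [LieRing 𝔤] [LieAlgebra ℝ 𝔤]

omit [NoZeroSMulDivisors ℝ F] in
/-- Evaluation of the represented bilinear form on a one-bond test field `u = δ_{(μ,x)}a`:
`H(δ_{(μ,x)}a, v) = Σ_{ν,y} β(a, v_ν(y))·E(μ,x;ν,y)`. [cite: Balaban1987RG1, (4.33) p.289] -/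
theorem repr_single_left (β : LinearMap.BilinForm ℝ 𝔤) (eV : V ≃ₗ[ℝ] 𝔤) (E : Λ → T → Λ → T → F)
    (v : Λ → T → V) (μ : Λ) (x : T) (a : 𝔤) :
    ∑ μ', ∑ x', ∑ ν, ∑ y, β (eV ((Pi.single μ (Pi.single x (eV.symm a)) : Λ → T → V) μ' x')) (eV (v ν y)) • E μ' x' ν y
      = ∑ ν, ∑ y, β a (eV (v ν y)) • E μ x ν y := by
  rw [Finset.sum_eq_single μ]
  · rw [Finset.sum_eq_single x]
    · simp
    · intro x' _ hx'
      simp [Pi.single_eq_of_ne hx']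
    · intro h; exact absurd (Finset.mem_univ x) h
  · intro μ' _ hμ'
    simp [Pi.single_eq_of_ne hμ']
  · intro h; exact absurd (Finset.mem_univ μ) h

omit [NoZeroSMulDivisors ℝ F] in
/-- Same on the right: `H(u, δ_{(ν,y)}b) = Σ_{μ,x} β(u_μ(x), b)·E(μ,x;ν,y)`. [cite: Balaban1987RG1, (4.33) p.289] -/
theorem repr_single_right (β : LinearMap.BilinForm ℝ 𝔤) (eV : V ≃ₗ[ℝ] 𝔤) (E : Λ → T → Λ → T → F)
    (u : Λ → T → V) (ν : Λ) (y : T) (b : 𝔤) :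
    ∑ μ, ∑ x, ∑ ν', ∑ y', β (eV (u μ x)) (eV ((Pi.single ν (Pi.single y (eV.symm b)) : Λ → T → V) ν' y')) • E μ x ν' y'
      = ∑ μ, ∑ x, β (eV (u μ x)) b • E μ x ν y := by
  refine Finset.sum_congr rfl fun μ _ => Finset.sum_congr rfl fun x _ => ?_
  rw [Finset.sum_eq_single ν]
  · rw [Finset.sum_eq_single y]
    · simp
    · intro y' _ hy'
      simp [Pi.single_eq_of_ne hy']
    · intro h; exact absurd (Finset.mem_univ y) h
  · intro ν' _ hν'
    simp [Pi.single_eq_of_ne hν']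
  · intro h; exact absurd (Finset.mem_univ ν) h

/-- **(I.4.15)₁ + the Schur representation ⇒ the kernel form for the scalar table, `y`-slot**: if `H(u, v) =
Σ β(u_μ(x), v_ν(y))·E(μ,x;ν,y)` and `H(u, ∂λ) = 0` for all 𝔤-valued `u`, `λ` (`(∂λ)_ν(y) = λ(y + e_ν) − λ(y)`, shifts `shift ν`),
then for every scalar gauge function `φ`: `Σ_{y,ν}(φ(y + e_ν) − φ(y))·E(μ,x;ν,y) = 0` — test with `u = δ_{(μ,x)}a`, `λ = φ·l`,
`β(a, l) ≠ 0` (print: `⟨𝐄, A⊗B⟩ = 𝐄 tr AB`, then (I.4.15)₁ with `B₁ = δ`, `λ` scalar times a generator).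
[cite: Balaban1988Convergent, (3.54) p.281] -/
theorem wardY_scalarTable (H : (Λ → T → V) → (Λ → T → V) → F) (β : LinearMap.BilinForm ℝ 𝔤) (eV : V ≃ₗ[ℝ] 𝔤)
    (E : Λ → T → Λ → T → F)
    (hrepr : ∀ u v, H u v = ∑ μ, ∑ x, ∑ ν, ∑ y, β (eV (u μ x)) (eV (v ν y)) • E μ x ν y)
    (shift : Λ → T → T) (hWT : ∀ (u : Λ → T → V) (lam : T → V), H u (fun ν y => lam (shift ν y) - lam y) = 0)
    {a l : 𝔤} (hal : β a l ≠ 0) (φ : T → ℝ) (μ : Λ) (x : T) :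
    ∑ y, ∑ ν, (φ (shift ν y) - φ y) • E μ x ν y = 0 := by
  have h := hWT (Pi.single μ (Pi.single x (eV.symm a))) (fun y => φ y • eV.symm l)
  rw [hrepr, repr_single_left] at h
  have e : ∑ ν, ∑ y, β a (eV ((fun ν y => φ (shift ν y) • eV.symm l - φ y • eV.symm l) ν y)) • E μ x ν y
      = β a l • ∑ y, ∑ ν, (φ (shift ν y) - φ y) • E μ x ν y := by
    rw [Finset.sum_comm, Finset.smul_sum]
    refine Finset.sum_congr rfl fun y _ => ?_
    rw [Finset.smul_sum]
    refine Finset.sum_congr rfl fun ν _ => ?_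
    dsimp only
    rw [← sub_smul, map_smul, LinearEquiv.apply_symm_apply, map_smul, smul_eq_mul, smul_smul]
    congr 1
    ring
  rw [e] at h
  exact (smul_eq_zero.1 h).resolve_left hal

/-- **The `x`-slot**: from `H(∂λ, v) = 0` (the symmetric slot) and the representation, for `β(l, b) ≠ 0`:
`Σ_{x,μ}(φ(x + e_μ) − φ(x))·E(μ,x;ν,y) = 0` — the identity used in (3.54). [cite: Balaban1988Convergent, (3.54) p.281] -/
theorem wardX_scalarTable (H : (Λ → T → V) → (Λ → T → V) → F) (β : LinearMap.BilinForm ℝ 𝔤) (eV : V ≃ₗ[ℝ] 𝔤)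
    (E : Λ → T → Λ → T → F)
    (hrepr : ∀ u v, H u v = ∑ μ, ∑ x, ∑ ν, ∑ y, β (eV (u μ x)) (eV (v ν y)) • E μ x ν y)
    (shift : Λ → T → T) (hWT' : ∀ (v : Λ → T → V) (lam : T → V), H (fun μ x => lam (shift μ x) - lam x) v = 0)
    {l b : 𝔤} (hlb : β l b ≠ 0) (φ : T → ℝ) (ν : Λ) (y : T) :
    ∑ x, ∑ μ, (φ (shift μ x) - φ x) • E μ x ν y = 0 := by
  have h := hWT' (Pi.single ν (Pi.single y (eV.symm b))) (fun x => φ x • eV.symm l)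
  rw [hrepr, repr_single_right] at h
  have e : ∑ μ, ∑ x, β (eV ((fun μ x => φ (shift μ x) • eV.symm l - φ x • eV.symm l) μ x)) b • E μ x ν y
      = β l b • ∑ x, ∑ μ, (φ (shift μ x) - φ x) • E μ x ν y := by
    rw [Finset.sum_comm, Finset.smul_sum]
    refine Finset.sum_congr rfl fun x _ => ?_
    rw [Finset.smul_sum]
    refine Finset.sum_congr rfl fun μ _ => ?_
    dsimp only
    rw [← sub_smul, map_smul, LinearEquiv.apply_symm_apply, map_smul, LinearMap.smul_apply, smul_eq_mul, smul_smul]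
    congr 1
    ring
  rw [e] at h
  exact (smul_eq_zero.1 h).resolve_left hlb

end ScalarTable

/-! ## §2. The lineage's setting: gauge invariance (4.7) + «G semisimple» + Schur ⇒ the scalar table and its Ward identities -/

section Lineage

variable {𝔄 : Type*} [NormedRing 𝔄] [NormedAlgebra ℝ 𝔄] [CompleteSpace 𝔄] {Λ T : Type*} [Fintype Λ] [Fintype T]
  [AddCommGroup T] [DecidableEq Λ] [DecidableEq T] {V : Type*} [NormedAddCommGroup V] [NormedSpace ℝ V]
  {F : Type*} [NormedAddCommGroup F] [NormedSpace ℝ F]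
  {𝔤 : Type*} [LieRing 𝔤] [LieAlgebra ℝ 𝔤] [FiniteDimensional ℝ 𝔤]

/-- **[I] (4.7) + (4.15)₁ + (4.33)/Schur ⇒ the scalar kernel table and its first Ward–Takahashi identity in kernel form
(both slots)**: for `𝐄` three times continuously differentiable at `V = 1` on `𝔄`-valued lattice gauge fields, gauge
invariant near `1` under the flows `V ↦ (e^{tρλ(b₋)}V(b)e^{−tρλ(b₊)})_b` of all 𝔤-valued `λ` ((4.7)), `G` semisimple with
scalar centroid, `β` an invariant nondegenerate form on `𝔤` (e.g. the trace/Killing form): there is a scalar table `E` with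
`D²[B ↦ 𝐄(exp ρB)](0)(u, v) = Σ β(u_μ(x), v_ν(y))·E(μ,x;ν,y)` (`B12Schur433.hessian_chart_eq_sum_scalar_kernel`), and it
satisfies `Σ_{y,ν}(φ(y + e_ν) − φ(y))·E(μ,x;ν,y) = 0` and `Σ_{x,μ}(φ(x + e_μ) − φ(x))·E(μ,x;ν,y) = 0` for every scalar `φ`
((I.4.15)₁ `B12Semisimple414.hessian_chart_apply_grad_eq_zero`, symmetric slot by `B12Schur433.hessian_chart_symm`).
[cite: Balaban1987RG1, (4.15) p.284, (4.33) p.289] -/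
theorem scalarTable_ward_of_gaugeInvariance [LieAlgebra.IsSemisimple ℝ 𝔤] (eV : V ≃ₗ[ℝ] 𝔤)
    {ℰ : (Λ → T → 𝔄) → F} (e : Λ → T) (ρ : V →L[ℝ] 𝔄)
    (hρ : ∀ a b : V, ρ (eV.symm ⁅eV a, eV b⁆) = ρ a * ρ b - ρ b * ρ a) (hℰ : ContDiffAt ℝ 3 ℰ 1)
    (h47 : ∀ lam : T → V, ∀ᶠ W in 𝓝 (1 : Λ → T → 𝔄), ∀ᶠ t in 𝓝 (0 : ℝ),
      ℰ (fun ν x => exp (t • ρ (lam x)) * W ν x * exp (-(t • ρ (lam (x + e ν))))) = ℰ W)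
    (β : LinearMap.BilinForm ℝ 𝔤) (hβ : β.lieInvariant 𝔤) (hβn : β.Nondegenerate)
    (hcen : ∀ φ : 𝔤 →ₗ[ℝ] 𝔤, (∀ x y : 𝔤, φ ⁅x, y⁆ = ⁅x, φ y⁆) → ∃ c : ℝ, ∀ x, φ x = c • x)
    {a l : 𝔤} (hal : β a l ≠ 0) (hla : β l a ≠ 0) :
    ∃ E : Λ → T → Λ → T → F,
      (∀ u v : Λ → T → V, fderiv ℝ (fderiv ℝ (fun B : Λ → T → V => ℰ (fun ν x => exp (ρ (B ν x))))) 0 u v =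
        ∑ μ, ∑ x, ∑ ν, ∑ y, β (eV (u μ x)) (eV (v ν y)) • E μ x ν y) ∧
      (∀ (φ : T → ℝ) (μ : Λ) (x : T), ∑ y, ∑ ν, (φ (y + e ν) - φ y) • E μ x ν y = 0) ∧
      (∀ (φ : T → ℝ) (ν : Λ) (y : T), ∑ x, ∑ μ, (φ (x + e μ) - φ x) • E μ x ν y = 0) := by
  obtain ⟨E, hE⟩ := B12Schur433.hessian_chart_eq_sum_scalar_kernel eV e ρ hρ hℰ h47 β hβ hβn hcen
  have hcl : ∀ a b : V, ∃ c : V, ρ c = ρ a * ρ b - ρ b * ρ a := B12Semisimple414.exists_rho_eq_commutator eV ρ hρ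
  have hspan := B12Semisimple414.span_commutatorSet_eq_top_of_isSemisimple eV (ρ : V → 𝔄) hρ
  have hWT : ∀ (u : Λ → T → V) (lam : T → V),
      fderiv ℝ (fderiv ℝ (fun B : Λ → T → V => ℰ (fun ν x => exp (ρ (B ν x))))) 0 u
        (fun ν y => lam (y + e ν) - lam y) = 0 :=
    fun u lam => B12Semisimple414.hessian_chart_apply_grad_eq_zero e ρ (hℰ.of_le (by norm_num)) h47 hcl hspan u lam
  have hWT' : ∀ (v : Λ → T → V) (lam : T → V),
      fderiv ℝ (fderiv ℝ (fun B : Λ → T → V => ℰ (fun ν x => exp (ρ (B ν x))))) 0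
        (fun μ x => lam (x + e μ) - lam x) v = 0 := by
    intro v lam
    rw [B12Schur433.hessian_chart_symm ρ hℰ]
    exact hWT v lam
  refine ⟨E, hE, fun φ μ x => ?_, fun φ ν y => ?_⟩
  · exact wardY_scalarTable _ β eV E hE (fun ν y => y + e ν) hWT hal φ μ x
  · exact wardX_scalarTable _ β eV E hE (fun μ x => x + e μ) hWT' hla φ ν y

end Lineage

/-! ## §3. Real-valued 𝐄, directions `Fin d`: (3.51) and (3.55) for the scalar table of a nonabelian invariant functional -/

section RealTable

variable {𝔄 : Type*} [NormedRing 𝔄] [NormedAlgebra ℝ 𝔄] [CompleteSpace 𝔄] {d : ℕ} {T : Type*} [Fintype T]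
  [AddCommGroup T] [DecidableEq T] {V : Type*} [NormedAddCommGroup V] [NormedSpace ℝ V]
  {𝔤 : Type*} [LieRing 𝔤] [LieAlgebra ℝ 𝔤] [FiniteDimensional ℝ 𝔤]

/-- **(3.51) and (3.55) for the scalar table `𝐄_{μν}(x, y)` of a nonabelian gauge-invariant real functional** — model note
(M1) of `B14Lem280Ward` discharged: under the hypotheses of `scalarTable_ward_of_gaugeInvariance` (real-valued `𝐄`,
directions `Fin d`), for the scalar table `E` read as the kernel `K_{μν}(x, y) = E(μ,x;ν,y)`, localized in a window `W` on
which the coordinates are affine along the shifts `x ↦ x + e_μ` (spacing `ξ ≠ 0`): `K` satisfies (3.51) and both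
antisymmetries (3.55) of its moment table (`B14.Lem280Ward.eq351`/`eq355a`/`eq355b` with their kernel-form Ward
hypotheses DERIVED from (4.7)). [cite: Balaban1988Convergent, (3.51)–(3.55) pp.280–281] -/
theorem eq355_scalarTable_of_gaugeInvariance [LieAlgebra.IsSemisimple ℝ 𝔤] (eV : V ≃ₗ[ℝ] 𝔤)
    {ℰ : (Fin d → T → 𝔄) → ℝ} (e : Fin d → T) (ρ : V →L[ℝ] 𝔄)
    (hρ : ∀ a b : V, ρ (eV.symm ⁅eV a, eV b⁆) = ρ a * ρ b - ρ b * ρ a) (hℰ : ContDiffAt ℝ 3 ℰ 1)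
    (h47 : ∀ lam : T → V, ∀ᶠ W in 𝓝 (1 : Fin d → T → 𝔄), ∀ᶠ t in 𝓝 (0 : ℝ),
      ℰ (fun ν x => exp (t • ρ (lam x)) * W ν x * exp (-(t • ρ (lam (x + e ν))))) = ℰ W)
    (β : LinearMap.BilinForm ℝ 𝔤) (hβ : β.lieInvariant 𝔤) (hβn : β.Nondegenerate)
    (hcen : ∀ φ : 𝔤 →ₗ[ℝ] 𝔤, (∀ x y : 𝔤, φ ⁅x, y⁆ = ⁅x, φ y⁆) → ∃ c : ℝ, ∀ x, φ x = c • x)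
    {a l : 𝔤} (hal : β a l ≠ 0) (hla : β l a ≠ 0)
    (W : Finset T) (coord : T → Fin d → ℝ) (z : T) {ξ : ℝ} (hξ : ξ ≠ 0)
    (hco : ∀ x ∈ W, ∀ μ κ, coord (x + e μ) κ = coord x κ + if κ = μ then ξ else 0) :
    ∃ E : Fin d → T → Fin d → T → ℝ,
      (∀ u v : Fin d → T → V, fderiv ℝ (fderiv ℝ (fun B : Fin d → T → V => ℰ (fun ν x => exp (ρ (B ν x))))) 0 u v =
        ∑ μ, ∑ x, ∑ ν, ∑ y, β (eV (u μ x)) (eV (v ν y)) * E μ x ν y) ∧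
      ((∀ μ ν x y, x ∉ W → E μ x ν y = 0) →
        (∀ ν y μ κ, ∑ x ∈ W, E μ x ν y * (coord x κ - coord z κ)
            = -∑ x ∈ W, E κ x ν y * (coord x μ - coord z μ)) ∧
        (∀ μ ν κ τ, moment2 (W ×ˢ W) (fun μ ν x y => E μ x ν y) coord z μ ν κ τ
            = -moment2 (W ×ˢ W) (fun μ ν x y => E μ x ν y) coord z κ ν μ τ)) ∧
      ((∀ μ ν x y, y ∉ W → E μ x ν y = 0) →
        (∀ μ ν κ τ, moment2 (W ×ˢ W) (fun μ ν x y => E μ x ν y) coord z μ ν κ τ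
            = -moment2 (W ×ˢ W) (fun μ ν x y => E μ x ν y) coord z μ τ κ ν)) := by
  obtain ⟨E, hE, hWy, hWx⟩ :=
    scalarTable_ward_of_gaugeInvariance eV e ρ hρ hℰ h47 β hβ hβn hcen hal hla
  refine ⟨E, ?_, fun hlocx => ?_, fun hlocy => ?_⟩
  · intro u v
    rw [hE u v]
    simp only [smul_eq_mul]
  · -- the window form of the `x`-slot identity for the kernel `K μ ν x y := E μ x ν y`
    have hW : ∀ (lam : T → ℝ) (ν : Fin d) (y : T),
        ∑ x ∈ W, ∑ μ, E μ x ν y * (lam (x + e μ) - lam x) = 0 := by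
      intro lam ν y
      have h := hWx lam ν y
      simp only [smul_eq_mul] at h
      have h' : ∑ x, ∑ μ, E μ x ν y * (lam (x + e μ) - lam x) = 0 := by
        rw [← h]
        exact Finset.sum_congr rfl fun x _ => Finset.sum_congr rfl fun μ _ => by ring
      exact Lem280Ward.wardX_window (K := fun μ ν x y => E μ x ν y) W (fun μ ν x y hx => hlocx μ ν x y hx) h'
    exact ⟨fun ν y μ κ => Lem280Ward.eq351 (fun μ ν x y => E μ x ν y) W (fun μ x => x + e μ) coord z hξ hco hW ν y μ κ,
      fun μ ν κ τ => Lem280Ward.eq355a (fun μ ν x y => E μ x ν y) W (fun μ x => x + e μ) coord z hξ hco hW μ ν κ τ⟩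
  · have hWy' : ∀ (lam : T → ℝ) (μ : Fin d) (x : T),
        ∑ y ∈ W, ∑ ν, E μ x ν y * (lam (y + e ν) - lam y) = 0 := by
      intro lam μ x
      have h := hWy lam μ x
      simp only [smul_eq_mul] at h
      have h' : ∑ y, ∑ ν, E μ x ν y * (lam (y + e ν) - lam y) = 0 := by
        rw [← h]
        exact Finset.sum_congr rfl fun y _ => Finset.sum_congr rfl fun ν _ => by ring
      rw [← h']
      refine Finset.sum_subset (Finset.subset_univ W) fun y _ hy => ?_
      exact Finset.sum_eq_zero fun ν _ => by rw [hlocy μ ν x y hy, zero_mul]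
    exact fun μ ν κ τ => Lem280Ward.eq355b (fun μ ν x y => E μ x ν y) W (fun μ x => x + e μ) coord z hξ hco hWy' μ ν κ τ

end RealTable

end Literature.MathematicalPhysics.QuantumFieldTheory.Balaban1983to89.B14.Lem280WardLie
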